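import Literature.NumberTheory.EllipticCurves.HeegnerPointsKolyvaginExceptionalTwistProofs
import HarnessLib

/-!
# [telescope v21 — LEAD cruxlead-19034 g9, 2026-08-30] KOLYVAGIN'S THEOREM A IS A CONSEQUENCE, INSIDE THE TREE, OF THREE OTHER BY-NAME INPUTS OF CRUX 4
# (`--supports`, helper; generic; closes nothing; moves no count by itself)

Crux 4 `BSDpOnCellC` (stmt-BirchSwinnertonDyer-19034), line «telescope» v21. Conjunct 9 of the inner block of the registered cite
stub `stub_publishedFacts` is `∀ (N : ℕ) [NeZero N] (W : WeierstrassCurve ℚ) (K : Type) [Field K] [NumberField K], kolyvagin N W K`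
(Kolyvagin 1990, Thm. A: a Heegner point of infinite order forces `rank E(K) = 1` and `Ш(E/K)` finite). The LEAD g9
kernel-level leaf census of the v21 conditional closure p783713 (`INPUT-LEAF-CENSUS-g9.md`) shows that this input is
CONSUMED at exactly one leaf of the cone (`Summit.BirchSwinnertonDyer.Rank1Residual.X11b.bsdp_of_indexIdentityAt`) and that
the cone ALSO carries, by name, Darmon 2004 Thm. 3.22 (`rank_eq_analyticRank_of_analyticRank_le_one`: `ord_{s=1} L(E,s) ≤ 1 ⇒
rank E(ℚ) = ord ∧ Ш(E/ℚ) finite`), the Gross–Zagier formula (`gross_zagier`) and modularity (`exists_isNewformOf`).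

WHAT: `kolyvagin_of_rank_eq_analyticRank` — from those three named facts ALONE (plus proved tree theorems) the statement
`kolyvagin N W K` holds at EVERY instance `(N, W, K)`: for a Heegner point `P ∈ E(K)` of level `N` of infinite order,
Gross–Zagier gives `L'(E/K, 1) ≠ 0`, hence `ord L(E) + ord L(E^{(d_K)}) = ord L(E/K) ≤ 1` (tree theorem
`analyticRank_add_le_one_of_isHeegnerPoint_of_not_isOfFinAddOrder`, modularity supplying the entire continuation); Thm. 3.22
applied to `E` and to `E^{(d_K)}` (both of analytic rank `≤ 1`) gives `rank E(ℚ) = ord L(E)`, `rank E^{(d_K)}(ℚ) = ord L(E^{(d_K)})`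
and the finiteness of `Ш(E/ℚ)`, `Ш(E^{(d_K)}/ℚ)`; then `rank E(K) = rank E(ℚ) + rank E^{(d_K)}(ℚ) ≤ 1`
(`mordellWeilRank_baseChange_quadratic_holds`, Silverman AEC Ex. 10.16), `rank E(K) ≥ 1` from `P` (Mordell–Weil,
`one_le_mordellWeilRank_of_not_isOfFinAddOrder`), and `Ш(E/K)` is finite by `shaFinite_baseChange_of_shaFinite`
(Milne 1972 §1 Thm. 1 in substance, proved in the tree). This is the twist route of
`HeegnerPointsKolyvaginExceptionalTwistProofs.mordellWeilRank_eq_one_and_shaFinite_of_thmA_on` with its Theorem-A-for-a-class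
input replaced by the named fact Thm. 3.22 itself; no root number, no Euler system over `K`, no auxiliary field.
`forall_kolyvagin_of_rank_eq_analyticRank` is the same statement in the universally closed shape of the cite stub's conjunct.

MEANING (honest): in PRINT, Darmon's Thm. 3.22 is proved FROM Kolyvagin's theorem; as TYPED, the register of crux 4 cites the
corollary (Thm. 3.22) and the input (Thm. A) side by side, and the former subsumes the latter given Gross–Zagier and modularity —
so the by-name input `kolyvagin` is REDUNDANT in the v21 composition. Whether and how the register is re-booked (27 → 26 by name,
refereed 23 → 22) is the host's / director's call on a landed closure (`…OfCitedFactsR4`), not this file's.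
HONEST FRAMING: theorems only (no definition, no named fact, no instance, no `sorry`); CONDITIONAL on its three named-fact
hypotheses (the gate records `proof.conditional`); closes no registered stub, no crux, no summit statement; BSD is proved for no
curve by this file.
References (shape only): [cite: Kolyvagin1990, Thm. A] [cite: GrossLMS1991, (1.1), Thm. 1.3] [cite: Darmon2004, Thm. 3.22 and §3.9]
[cite: GrossZagier1986, Thm. I.6.3, I.§7] [cite: SilvermanAEC2009, Exercise 10.16] [cite: Milne1972ArithmeticAV, §1 Thm. 1]
-/

set_option autoImplicit false
set_option linter.dupNamespace false

noncomputable section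

open scoped Classical

open WeierstrassCurve NumberField Literature.NumberTheory.EllipticCurves
  Literature.NumberTheory.EllipticCurves.ModularForms

namespace Summit.BirchSwinnertonDyer.BirchSwinnertonDyer.Theorems.EisensteinPrimesBSDpOnCellCKolyvaginOfGZK

/-- **Kolyvagin's Theorem A at every instance `(N, W, K)` from Darmon 2004 Thm. 3.22, Gross–Zagier and modularity.** For
`W/ℚ` elliptic, `K` imaginary quadratic with the Heegner hypothesis for `N`, and a Heegner point `P ∈ E(K)` of level `N` of
infinite order: `rank E(K) = 1` and `Ш(E/K)` is finite. Proof: `ord L(E) + ord L(E^{(d_K)}) ≤ 1`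
(`analyticRank_add_le_one_of_isHeegnerPoint_of_not_isOfFinAddOrder`, from `hGZ` and the entire continuation given by `hnf`);
Thm. 3.22 (`hGZK`) for `E` and for `E^{(d_K)}`; `rank E(K) = rank E(ℚ) + rank E^{(d_K)}(ℚ)`
(`mordellWeilRank_baseChange_quadratic_holds`); `1 ≤ rank E(K)` from `P` (`one_le_mordellWeilRank_of_not_isOfFinAddOrder`);
`Ш(E/K)` finite from `Ш(E/ℚ)`, `Ш(E^{(d_K)}/ℚ)` finite (`shaFinite_baseChange_of_shaFinite`). CONDITIONAL on the three named
facts. [cite: Kolyvagin1990, Thm. A] [cite: Darmon2004, Thm. 3.22 and §3.9] [cite: GrossZagier1986, Thm. I.6.3, I.§7] -/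
theorem kolyvagin_of_rank_eq_analyticRank (hGZK : rank_eq_analyticRank_of_analyticRank_le_one)
    (hnf : exists_isNewformOf)
    (hGZ : ∀ (N : ℕ) [NeZero N] (W : WeierstrassCurve ℚ) (K : Type) [Field K] [NumberField K],
      gross_zagier N W K)
    (N : ℕ) [NeZero N] (W : WeierstrassCurve ℚ) (K : Type) [Field K] [NumberField K] :
    kolyvagin N W K := by
  intro _ hK hH P hP hnt
  haveI : (W.baseChange K).IsElliptic := by rw [baseChange]; infer_instance
  have hE : hasEntireLFunction_rat := WeierstrassCurve.hasEntireLFunction_rat_of_exists_isNewformOf hnf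
  -- Gross–Zagier at `(N, E, K)`: `ord L(E) + ord L(E^{(d_K)}) ≤ 1`
  have hsum := analyticRank_add_le_one_of_isHeegnerPoint_of_not_isOfFinAddOrder hE (hGZ N W K) hK hH hP hnt
  -- Thm. 3.22 for `E` and for `E^{(d_K)}`
  have hd : (NumberField.discr K : ℚ) ≠ 0 := by exact_mod_cast NumberField.discr_ne_zero K
  haveI := W.isElliptic_quadraticTwist hd
  obtain ⟨hrW, hsW⟩ := hGZK W (by omega)
  obtain ⟨hrd, hsd⟩ := hGZK (W.quadraticTwist (NumberField.discr K : ℚ)) (by omega)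
  -- the rank over `K`
  have hrk := mordellWeilRank_baseChange_quadratic_holds W K hK.1
  have hge : 1 ≤ (W.baseChange K).mordellWeilRank :=
    one_le_mordellWeilRank_of_not_isOfFinAddOrder _ (W.baseChange K).module_finite_point_holds hnt
  exact ⟨by omega, shaFinite_baseChange_of_shaFinite W K hK.1 hsW hsd⟩

/-- **The cite stub's conjunct, universally closed**: `∀ N W K, kolyvagin N W K` — the EXACT text of conjunct 9 of the inner block
of telescope v21's `stub_publishedFacts` / of `hPub` in `…OfCitedFactsR3.bsdpOnCellC_of_citedFactsR_pre3` — from Thm. 3.22,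
modularity and Gross–Zagier (conjuncts 10, 6 and 8 of the same block). CONDITIONAL on those three named facts.
[cite: Kolyvagin1990, Thm. A] [cite: Darmon2004, Thm. 3.22] -/
theorem forall_kolyvagin_of_rank_eq_analyticRank (hGZK : rank_eq_analyticRank_of_analyticRank_le_one)
    (hnf : exists_isNewformOf)
    (hGZ : ∀ (N : ℕ) [NeZero N] (W : WeierstrassCurve ℚ) (K : Type) [Field K] [NumberField K],
      gross_zagier N W K) :
    ∀ (N : ℕ) [NeZero N] (W : WeierstrassCurve ℚ) (K : Type) [Field K] [NumberField K],
      kolyvagin N W K :=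
  fun N _ W K _ _ ↦ kolyvagin_of_rank_eq_analyticRank hGZK hnf hGZ N W K

end Summit.BirchSwinnertonDyer.BirchSwinnertonDyer.Theorems.EisensteinPrimesBSDpOnCellCKolyvaginOfGZK

end
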